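import Mathlib
import Summits.ValiantsHypothesis.ValiantsHypothesis.Theorems.LacunarySymmetroidMatrixDescartesCensusRealExponentsDoors

/-!
# `MatrixDescartes` census — the doors as ONE compact problem: normal form on the simplex of real exponents

HONEST FRAMING.  Object-search cell `pub-symmetroid`, items `DoorA26 = PosRootLawAt 2 6 19`
(stmt-ValiantsHypothesis-19979) and `DoorA34 = PosRootLawAt 3 4 18` (stmt-ValiantsHypothesis-19980),
both OPEN, typed, never asserted; this file is an elementary normal form for the real-exponent
currency of `…CensusRealExponentsDoors` and decides nothing.  Nothing here bears on `MatrixDescartes`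
(stmt-ValiantsHypothesis-18050) or `VP ≠ VNP`.

* `ncard_expPencil_affine` — the zero count of `t ↦ det ∑_l e^{δ_l t} S_l` is unchanged under an
  affine change of the exponent vector `δ ↦ a + c·δ` (`c ≠ 0`): `e^{(a + cδ_l)t} = e^{at}·e^{δ_l (ct)}`
  and `det` is homogeneous;
* `ncard_expPencil_perm` — and under a simultaneous permutation of letters and exponents;
* `realRow_iff_simplex` — hence a real-exponent row `∀ δ S, #zeros ≤ B` holds iff it holds for
  exponent vectors in the COMPACT SIMPLEX `Δ = {δ monotone, δ₀ = 0, δ_last = 1}` (the constant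
  exponent vectors, which have no normal form, carry no zeros at all or the zero determinant);
* `posRootLawAt_of_frequently_shell` — **infinitely many SHELLS suffice**: for a sharp bound, if
  for infinitely many `N` the row holds on the finite shell of sorted integer supports
  `0 = d₀ ≤ ⋯ ≤ d_last = N`, it holds for all supports (normalise a real counterexample into the
  simplex, take its ball of persistent brackets, and hit it with the lattice point `⌊Nδ⌋/N`);
  `doorA26_iff_frequently_shell`, `doorA34_iff_frequently_shell` — what survives of the literal
  «box reduction» asked of seat val-sym-door-p1: not one box, but any infinite family of shells;
* `doorA26_iff_simplex`, `doorA34_iff_simplex` — with `doorA26_iff_rpow` / `doorA34_iff_rpow`: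
  **`DoorA26` (all integer supports) ⟺ every real symmetric six-letter `2 × 2` pencil with exponent
  vector in the compact 4-simplex `0 = δ₀ ≤ δ₁ ≤ ⋯ ≤ δ₅ = 1` has `≤ 19` zeros on `(0,∞)`**, and the
  same for `DoorA34` on the 2-simplex.  Together with the openness of the residue
  (`isOpen_twentyLocus_two_six`) this is the precise form of «the all-supports residue is a compact
  family of local problems» (report DOOR-A-P1-REPORT §26).

[folklore] Elementary substitutions `x ↦ x^{1/c}`, `x ↦ x·$e^{a}$`, relabelling of letters.
-/

-- `Summit.ValiantsHypothesis.ValiantsHypothesis.…` repeats a component by the D-0017 layout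
-- (single-conjunct summit), which the `dupNamespace` linter flags; the name is mandated.
set_option linter.dupNamespace false

namespace Summit.ValiantsHypothesis.ValiantsHypothesis.Theorems.LacunarySymmetroidMatrixDescartes.Census.RealExp

open Finset
open scoped BigOperators Matrix

section NormalForm

variable {m K : ℕ}

/-- **Affine invariance of the zero count.**  For `c ≠ 0` and any `a`, the pencils with exponent
vectors `δ` and `l ↦ a + c·δ_l` have the same number of zeros in `t` (`t ↦ c·t` matches them).
[folklore] -/
theorem ncard_expPencil_affine (δ : Fin K → ℝ) (S : Fin K → Matrix (Fin m) (Fin m) ℝ) (a : ℝ)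
    {c : ℝ} (hc : c ≠ 0) :
    {t : ℝ | (∑ l, Real.exp ((a + c * δ l) * t) • S l).det = 0}.ncard =
      {t : ℝ | (∑ l, Real.exp (δ l * t) • S l).det = 0}.ncard := by
  classical
  have hfac : ∀ t, (∑ l, Real.exp ((a + c * δ l) * t) • S l) =
      Real.exp (a * t) • ∑ l, Real.exp (δ l * (c * t)) • S l := by
    intro t
    rw [Finset.smul_sum]
    refine Finset.sum_congr rfl fun l _ => ?_
    rw [smul_smul, ← Real.exp_add]
    congr 1; congr 1; ring
  have hzero : ∀ t, (∑ l, Real.exp ((a + c * δ l) * t) • S l).det = 0 ↔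
      (∑ l, Real.exp (δ l * (c * t)) • S l).det = 0 := by
    intro t
    rw [hfac t, Matrix.det_smul, Fintype.card_fin]
    constructor
    · intro h
      rcases mul_eq_zero.mp h with h | h
      · exact absurd h (pow_ne_zero _ (Real.exp_pos _).ne')
      · exact h
    · intro h; rw [h, mul_zero]
  have himage : (fun t => c * t) '' {t : ℝ | (∑ l, Real.exp ((a + c * δ l) * t) • S l).det = 0} =
      {t : ℝ | (∑ l, Real.exp (δ l * t) • S l).det = 0} := by
    ext u
    constructor
    · rintro ⟨t, ht, rfl⟩
      exact (hzero t).mp ht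
    · intro hu
      refine ⟨u / c, ?_, by field_simp⟩
      rw [Set.mem_setOf_eq, hzero, mul_div_cancel₀ _ hc]
      exact hu
  rw [← himage, Set.ncard_image_of_injective _ (mul_right_injective₀ hc)]

/-- **Relabelling invariance.**  Permuting letters and exponents simultaneously does not change the
pencil. [folklore] -/
theorem expPencil_perm (δ : Fin K → ℝ) (S : Fin K → Matrix (Fin m) (Fin m) ℝ) (σ : Equiv.Perm (Fin K))
    (t : ℝ) : (∑ l, Real.exp (δ (σ l) * t) • S (σ l)) = ∑ l, Real.exp (δ l * t) • S l :=
  Equiv.sum_comp σ (fun l => Real.exp (δ l * t) • S l)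

/-- **Normal form on the simplex.**  A real-exponent row «`≤ B` zeros on `(0,∞)` for every exponent
vector `δ : Fin (k+1) → ℝ` and all symmetric letters» holds iff it holds for the exponent vectors of
the compact simplex `{δ monotone, δ 0 = 0, δ (last) = 1}`: translate by `−min δ`, divide by
`max δ − min δ` (when positive) and sort the letters; a constant exponent vector gives
`det = x^{m δ₀}·det(∑ S_l)`, with no zeros or identically zero (`ncard = 0` either way). [folklore] -/
theorem realRow_iff_simplex {k B : ℕ} :
    (∀ (δ : Fin (k + 1) → ℝ) (S : Fin (k + 1) → Matrix (Fin m) (Fin m) ℝ), (∀ l, (S l).IsSymm) →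
        {x : ℝ | 0 < x ∧ (∑ l, (x ^ (δ l)) • S l).det = 0}.ncard ≤ B) ↔
      ∀ (δ : Fin (k + 1) → ℝ), Monotone δ → δ 0 = 0 → δ (Fin.last k) = 1 →
        ∀ (S : Fin (k + 1) → Matrix (Fin m) (Fin m) ℝ), (∀ l, (S l).IsSymm) →
          {x : ℝ | 0 < x ∧ (∑ l, (x ^ (δ l)) • S l).det = 0}.ncard ≤ B := by
  classical
  constructor
  · intro h δ _ _ _ S hS
    exact h δ S hS
  · intro h δ S hS
    rw [ncard_rpow_eq_ncard_exp]
    -- min and max of `δ`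
    obtain ⟨i₀, hi₀⟩ := Finite.exists_min δ
    obtain ⟨i₁, hi₁⟩ := Finite.exists_max δ
    set a : ℝ := δ i₀ with ha
    set c : ℝ := δ i₁ - δ i₀ with hc
    rcases eq_or_lt_of_le (sub_nonneg.mpr (hi₀ i₁) : (0 : ℝ) ≤ c) with hc0 | hcpos
    · -- constant exponent vector: no zeros, or the zero determinant
      have hconst : ∀ l, δ l = a := by
        intro l
        have h1 := hi₀ l
        have h2 := hi₁ l
        have h3 : δ i₁ = δ i₀ := by linarith
        rw [ha]; linarith
      have hdet : ∀ t, (∑ l, Real.exp (δ l * t) • S l).det =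
          Real.exp (a * t) ^ m * (∑ l, S l).det := by
        intro t
        have : (∑ l, Real.exp (δ l * t) • S l) = Real.exp (a * t) • ∑ l, S l := by
          rw [Finset.smul_sum]
          refine Finset.sum_congr rfl fun l _ => ?_
          rw [hconst l]
        rw [this, Matrix.det_smul, Fintype.card_fin]
      by_cases hS0 : (∑ l, S l).det = 0
      · have : {t : ℝ | (∑ l, Real.exp (δ l * t) • S l).det = 0} = Set.univ := by
          refine Set.eq_univ_iff_forall.mpr fun t => ?_
          rw [Set.mem_setOf_eq, hdet, hS0, mul_zero]
        rw [this, Set.infinite_univ.ncard]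
        exact Nat.zero_le B
      · have : {t : ℝ | (∑ l, Real.exp (δ l * t) • S l).det = 0} = ∅ := by
          refine Set.eq_empty_iff_forall_notMem.mpr fun t ht => ?_
          rw [Set.mem_setOf_eq, hdet] at ht
          rcases mul_eq_zero.mp ht with h1 | h1
          · exact absurd h1 (pow_ne_zero _ (Real.exp_pos _).ne')
          · exact hS0 h1
        rw [this, Set.ncard_empty]
        exact Nat.zero_le B
    · -- normalise: `δ = a + c · δ̃` with `δ̃ = (δ - a)/c ∈ [0,1]`, then sort
      set δ' : Fin (k + 1) → ℝ := fun l => (δ l - a) / c with hδ'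
      have hcne : c ≠ 0 := hcpos.ne'
      have haff : ∀ l, δ l = a + c * δ' l := by
        intro l; rw [hδ']; field_simp; ring
      have h1 : {t : ℝ | (∑ l, Real.exp (δ l * t) • S l).det = 0}.ncard =
          {t : ℝ | (∑ l, Real.exp (δ' l * t) • S l).det = 0}.ncard := by
        have : (fun t : ℝ => (∑ l, Real.exp (δ l * t) • S l).det) =
            fun t => (∑ l, Real.exp ((a + c * δ' l) * t) • S l).det := by
          funext t
          refine congrArg Matrix.det (Finset.sum_congr rfl fun l _ => ?_)
          rw [← haff l]
        rw [show {t : ℝ | (∑ l, Real.exp (δ l * t) • S l).det = 0} =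
            {t : ℝ | (∑ l, Real.exp ((a + c * δ' l) * t) • S l).det = 0} from by
          ext t; simp only [Set.mem_setOf_eq]; rw [← congrFun this t]]
        exact ncard_expPencil_affine δ' S a hcne
      rw [h1]
      -- sort the letters
      set σ : Equiv.Perm (Fin (k + 1)) := Tuple.sort δ' with hσ
      have hmono : Monotone (δ' ∘ σ) := Tuple.monotone_sort δ'
      have h2 : {t : ℝ | (∑ l, Real.exp (δ' l * t) • S l).det = 0} =
          {t : ℝ | (∑ l, Real.exp ((δ' ∘ σ) l * t) • (S ∘ σ) l).det = 0} := by
        ext t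
        simp only [Set.mem_setOf_eq, Function.comp]
        rw [expPencil_perm δ' S σ t]
      rw [h2]
      -- endpoint values of the sorted vector
      have hcpos' : (0 : ℝ) < c := hcpos
      have hδ'nonneg : ∀ l, 0 ≤ δ' l := fun l => by
        show 0 ≤ (δ l - a) / c
        exact div_nonneg (by linarith [hi₀ l, ha]) hcpos'.le
      have hδ'le : ∀ l, δ' l ≤ 1 := fun l => by
        show (δ l - a) / c ≤ 1
        rw [div_le_one hcpos']
        linarith [hi₁ l, hc, ha]
      have hδ'i₀ : δ' i₀ = 0 := by
        show (δ i₀ - a) / c = 0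
        rw [ha, sub_self, zero_div]
      have hδ'i₁ : δ' i₁ = 1 := by
        show (δ i₁ - a) / c = 1
        rw [div_eq_one_iff_eq hcne]
      have hzero : (δ' ∘ σ) 0 = 0 := by
        apply le_antisymm
        · have := hmono (Fin.zero_le (σ.symm i₀))
          simp only [Function.comp, Equiv.apply_symm_apply] at this
          rw [hδ'i₀] at this
          exact this
        · exact hδ'nonneg _
      have hlast : (δ' ∘ σ) (Fin.last k) = 1 := by
        apply le_antisymm
        · exact hδ'le _
        · have := hmono (Fin.le_last (σ.symm i₁))
          simp only [Function.comp, Equiv.apply_symm_apply] at this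
          rw [hδ'i₁] at this
          exact this
      have h3 := h (δ' ∘ σ) hmono hzero hlast (S ∘ σ) (fun l => hS (σ l))
      rw [ncard_rpow_eq_ncard_exp] at h3
      exact h3

end NormalForm

section Shells

variable {m : ℕ}

open Summit.ValiantsHypothesis.ValiantsHypothesis.Theorems.MatrixDescartes.Negative (PosRootLawAt)
open Summit.ValiantsHypothesis.ValiantsHypothesis.Theorems.SymmetroidDescartes (eval_det_pencil)
open Polynomial

/-- **Infinitely many SHELLS suffice (the honest form of a «box reduction»).**  For a sharp bound,
if for infinitely many spreads `N` the row holds on every sorted integer support with `d₀ = 0` and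
`d_last = N` (one SHELL of supports, a finite set), then the row holds for ALL supports.  Reason: a
counterexample over real exponents may be normalised into the simplex and has persistent sign brackets
on a ball of radius `r`; every shell `N > 1/r` contains the lattice point `⌊N δ⌋/N` of that ball, whose
integer support `⌊N δ⌋` (spread exactly `N`) then carries `≥ B + 1` positive roots. [folklore] -/
theorem posRootLawAt_of_frequently_shell {k B : ℕ}
    (hB : (univ.filter (fun lam : Fin m → Fin (k + 1) => Monotone lam)).card ≤ B + 2)
    (h : ∀ N₀ : ℕ, ∃ N : ℕ, N₀ ≤ N ∧ ∀ d : Fin (k + 1) → ℕ, Monotone d → d 0 = 0 →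
      d (Fin.last k) = N → PosRootLawOn m (k + 1) B d) :
    PosRootLawAt m (k + 1) B := by
  classical
  rw [posRootLawAt_iff_rpow hB, realRow_iff_simplex]
  intro δ hmono h0 h1 S hS
  by_contra hcon
  push Not at hcon
  rw [ncard_rpow_eq_ncard_exp δ S] at hcon
  obtain ⟨n, hnB, a, b, hab, hdisj, r, hr, hball⟩ :=
    exists_persistent_brackets hB δ S (by omega)
  obtain ⟨N, hN0, hN⟩ := h (⌈1 / r⌉₊ + 1)
  have hNpos : 0 < N := lt_of_lt_of_le (Nat.succ_pos _) hN0
  have hNpos' : (0 : ℝ) < N := by exact_mod_cast hNpos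
  have hNr : 1 / (N : ℝ) < r := by
    have h2 : 1 / r < (N : ℝ) := by
      have h3 : (⌈1 / r⌉₊ : ℝ) + 1 ≤ N := by exact_mod_cast hN0
      exact ((Nat.le_ceil (1 / r)).trans_lt (lt_add_one _)).trans_le h3
    exact (one_div_lt hNpos' hr).mpr h2
  have hδnonneg : ∀ l, 0 ≤ δ l := fun l => by rw [← h0]; exact hmono (Fin.zero_le l)
  -- the lattice point `z / N`, `z = ⌊N δ⌋`, of the shell `N`
  set z : Fin (k + 1) → ℕ := fun l => ⌊δ l * N⌋₊ with hz
  have hzmono : Monotone z := fun i j hij =>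
    Nat.floor_le_floor (mul_le_mul_of_nonneg_right (hmono hij) hNpos'.le)
  have hz0 : z 0 = 0 := by simp [hz, h0]
  have hzN : z (Fin.last k) = N := by simp [hz, h1]
  have hdist : dist (fun l => ((z l : ℕ) : ℝ) / N) δ < r := by
    rw [dist_pi_lt_iff hr]
    intro l
    rw [Real.dist_eq]
    have h4 : ((z l : ℕ) : ℝ) ≤ δ l * N := Nat.floor_le (mul_nonneg (hδnonneg l) hNpos'.le)
    have h5 : δ l * N < ((z l : ℕ) : ℝ) + 1 := Nat.lt_floor_add_one _
    have heq : ((z l : ℕ) : ℝ) / N - δ l = (((z l : ℕ) : ℝ) - δ l * N) / N := by field_simp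
    have h6 : |((z l : ℕ) : ℝ) / N - δ l| ≤ 1 / N := by
      rw [heq, abs_le]
      constructor
      · rw [le_div_iff₀ hNpos']
        have : -(1 / (N : ℝ)) * N = -1 := by field_simp
        rw [this]; linarith
      · exact div_le_div_of_nonneg_right (by linarith) hNpos'.le
    exact h6.trans_lt hNr
  have hsign := hball (fun l => ((z l : ℕ) : ℝ) / N) hdist
  -- zeros inside the brackets
  have hzeros : ∀ i, ∃ w ∈ Set.Ioo (a i) (b i),
      (∑ l, Real.exp ((((z l : ℕ) : ℝ) / N) * w) • S l).det = 0 :=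
    fun i => exists_zero_of_mul_neg (hab i)
      (continuous_det_expPencil (fun l => ((z l : ℕ) : ℝ) / N) S).continuousOn (hsign i)
  choose w hwmem hw0 using hzeros
  have hwmono : StrictMono w := by
    intro i j hij
    have h7 := (hwmem i).2
    have h8 := (hwmem j).1
    have h9 := hdisj i j hij
    linarith
  -- the integer pencil on the support `z`, along `x = e^{t/N}`
  have hpow : ∀ (l : Fin (k + 1)) (t : ℝ),
      Real.exp (t / N) ^ (z l) = Real.exp ((((z l : ℕ) : ℝ) / N) * t) := by
    intro l t
    rw [← Real.exp_nat_mul]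
    congr 1
    field_simp
  set P : ℝ[X] := (∑ l, (X : ℝ[X]) ^ z l • (S l).map C).det with hP
  have hPeval : ∀ t, P.eval (Real.exp (t / N)) =
      (∑ l, Real.exp ((((z l : ℕ) : ℝ) / N) * t) • S l).det := by
    intro t
    rw [hP, eval_det_pencil]
    refine congrArg Matrix.det (Finset.sum_congr rfl fun l _ => ?_)
    rw [hpow]
  have hn0 : 0 < n := by omega
  have hPne : P ≠ 0 := by
    intro hP0
    have h10 : P.eval (Real.exp (a ⟨0, hn0⟩ / N)) = 0 := by rw [hP0, eval_zero]
    rw [hPeval] at h10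
    have h11 := hsign ⟨0, hn0⟩
    rw [h10, zero_mul] at h11
    exact lt_irrefl 0 h11
  set xs : Fin n → ℝ := fun i => Real.exp (w i / N) with hxs
  have hxsinj : Function.Injective xs := by
    intro i j hij
    have h12 := Real.exp_injective hij
    have h13 : w i = w j := by
      have h14 : w i / N * N = w j / N * N := by rw [h12]
      rwa [div_mul_cancel₀ _ hNpos'.ne', div_mul_cancel₀ _ hNpos'.ne'] at h14
    exact hwmono.injective h13
  have hsub : univ.image xs ⊆ P.roots.toFinset.filter (fun x => 0 < x) := by
    intro x hx
    rw [Finset.mem_image] at hx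
    obtain ⟨i, -, rfl⟩ := hx
    rw [Finset.mem_filter, Multiset.mem_toFinset, mem_roots hPne, IsRoot.def]
    refine ⟨?_, Real.exp_pos _⟩
    show P.eval (Real.exp (w i / N)) = 0
    rw [hPeval]; exact hw0 i
  have hcard := Finset.card_le_card hsub
  rw [Finset.card_image_of_injective _ hxsinj, Finset.card_univ, Fintype.card_fin] at hcard
  have hle := hN z hzmono hz0 hzN S hS
  rw [← hP] at hle
  omega

end Shells

section Doors

/-- **`DoorA26` as one compact problem.**  `DoorA26` (all integer supports) holds iff every real
symmetric six-letter `2 × 2` pencil `∑_l x^{δ_l} S_l` whose exponent vector lies in the compact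
4-simplex `0 = δ₀ ≤ δ₁ ≤ ⋯ ≤ δ₅ = 1` has at most `19` zeros on `(0,∞)`. [folklore] -/
theorem doorA26_iff_simplex :
    DoorA26 ↔ ∀ (δ : Fin 6 → ℝ), Monotone δ → δ 0 = 0 → δ (Fin.last 5) = 1 →
      ∀ (S : Fin 6 → Matrix (Fin 2) (Fin 2) ℝ), (∀ l, (S l).IsSymm) →
        {x : ℝ | 0 < x ∧ (∑ l, (x ^ (δ l)) • S l).det = 0}.ncard ≤ 19 :=
  doorA26_iff_rpow.trans (realRow_iff_simplex (m := 2) (k := 5) (B := 19))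

/-- **`DoorA34` as one compact problem**: the same on the 2-simplex `0 = δ₀ ≤ δ₁ ≤ δ₂ ≤ δ₃ = 1` of
four-letter exponent vectors, bound `18`. [folklore] -/
theorem doorA34_iff_simplex :
    DoorA34 ↔ ∀ (δ : Fin 4 → ℝ), Monotone δ → δ 0 = 0 → δ (Fin.last 3) = 1 →
      ∀ (S : Fin 4 → Matrix (Fin 3) (Fin 3) ℝ), (∀ l, (S l).IsSymm) →
        {x : ℝ | 0 < x ∧ (∑ l, (x ^ (δ l)) • S l).det = 0}.ncard ≤ 18 :=
  doorA34_iff_rpow.trans (realRow_iff_simplex (m := 3) (k := 3) (B := 18))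

open Summit.ValiantsHypothesis.ValiantsHypothesis.Theorems.MatrixDescartes.Negative (PosRootLawAt) in
/-- **`DoorA26` from infinitely many shells.**  `DoorA26` holds iff for infinitely many spreads `N`
the row `PosRootLawOn 2 6 19 d` holds on every sorted support `0 = d₀ ≤ d₁ ≤ ⋯ ≤ d₅ = N` — a
countable family of FINITE verification problems of which any infinite subfamily suffices (e.g. the
shells `N = 2^j`); this is what survives of the literal «box reduction» (no single box can suffice
by topology alone, `isOpen_twentyLocus_two_six`). [folklore] -/
theorem doorA26_iff_frequently_shell :
    DoorA26 ↔ ∀ N₀ : ℕ, ∃ N : ℕ, N₀ ≤ N ∧ ∀ d : Fin 6 → ℕ, Monotone d → d 0 = 0 →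
      d (Fin.last 5) = N → PosRootLawOn 2 6 19 d := by
  constructor
  · intro h N₀
    exact ⟨N₀, le_rfl, fun d _ _ _ => fun S hS => h d S hS⟩
  · intro h
    exact posRootLawAt_of_frequently_shell (m := 2) (k := 5) (B := 19)
      (by rw [card_monotone_two_six]) h

open Summit.ValiantsHypothesis.ValiantsHypothesis.Theorems.MatrixDescartes.Negative (PosRootLawAt) in
/-- **`DoorA34` from infinitely many shells** (the same at `(3,4)`, bound `18`). [folklore] -/
theorem doorA34_iff_frequently_shell :
    DoorA34 ↔ ∀ N₀ : ℕ, ∃ N : ℕ, N₀ ≤ N ∧ ∀ d : Fin 4 → ℕ, Monotone d → d 0 = 0 →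
      d (Fin.last 3) = N → PosRootLawOn 3 4 18 d := by
  constructor
  · intro h N₀
    exact ⟨N₀, le_rfl, fun d _ _ _ => fun S hS => h d S hS⟩
  · intro h
    exact posRootLawAt_of_frequently_shell (m := 3) (k := 3) (B := 18)
      (by rw [card_monotone_three_four]) h

end Doors

end Summit.ValiantsHypothesis.ValiantsHypothesis.Theorems.LacunarySymmetroidMatrixDescartes.Census.RealExp
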